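import Summits.ValiantsHypothesis.ValiantsHypothesis.Theorems.FifoMatchingNNDivisionHardConePricing

/-!
# CONE PRICING on the zonotope chapter of COR-VIRTUAL (crux `NNDivisionHard`, stmt-ValiantsHypothesis-21181) — part 2/5 — §9 THE SCHEMA; §10–§11: the antitone cone has an explicit EF of size `2h² + h` and the corona cone is its polar; §13

Theorems-side port (val-port-1 g3, presser; declaration texts VERBATIM, one-line docstrings added where the gate lint wants them) of val-idea-44
g0's author-staged transplant `FifoMatchingNNDivisionHardConePricing.lean` (sha16 51fc894432d3ede5) of the crux workfile
`Cruxes/NNDivisionHard/ConePricing44.lean` rev 10 @0a2b2fead3a1 (W5-R2; critic of record val-idea-crit-9 g1: WAVE-5 LIST row (6) KEEP §G(3)+(4),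
ADDENDUM A4 SIG-FIRST GO 2026-08-28T22:04:39Z), split by the 400-line cap into five modules: `…ConePricing` (§2–§8) → `…Antitone` (§9–§11, §13)
→ `…Corona` (§12); `…ConePricing` → `…BalancedFaceZones` (§14, zones) → `…BalancedFace` (§14 theorem, §14b).  Statement-free (δ-unfolded `Prop`s).

* §9 THE SCHEMA (definition-free): `RootedSandwichWitness`/`FanExpensiveBeyond`/`FanCheapUpTo` δ-unfolded — `three_pow_le_of_witness`,
  `not_hasEF_of_witness`, `fanCheap_of_hasEF` (N13: a budgeted zonotope is fan-cheap at every located level).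
* §10 `antitoneCone_hasEF : HasEFOfSize (antitoneCone h) (2h²+h)`, `antitone_iff_generators_nonpos`.
* §11 `coronaCone_polar_antitone` (the apex normal chamber of `Z'_cor` is exactly the antitone cone; Farkas half over
  `Literature.Barriers.PneNP.farkas`), `mem_coronaCone_of_polar`.  §13 loose end: `cliqueCone_three_pow_le` (the UNROOTED clique cone is hard).

HONEST LABEL: helper rows for an OPEN crux (21181 `NNDivisionHard` OPEN; COR-VIRTUAL / `CovZonoHard` OPEN); nothing here is a summit
statement; VP ≠ VNP is NOT proved.
-/

set_option autoImplicit false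
-- the mandated summit-side namespace repeats a component by design (single-problem summit)
set_option linter.dupNamespace false

noncomputable section
open Matrix Finset
open scoped Pointwise

namespace Summit.ValiantsHypothesis.ValiantsHypothesis.Theorems.FifoMatching

namespace ConePricing

open Literature.Barriers.PneNP (HasEFOfSize)
open Literature.Combinatorics.Optimization (corPolytopeGraph corVec)

variable {h : ℕ}

/-! ## 9. THE SCHEMA, definition-free: located rooted-sandwich witnesses forbid a budget (the crux workfile names the predicate
`RootedSandwichWitness Z n`, fan-expensiveness `FanExpensiveBeyond Z R` and N13 `FanCheapUpTo Z R`; here they are δ-unfolded). -/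

/-- ★ PROVED: a LOCATED ROOTED-SANDWICH WITNESS of dimension `n` for `Z ⊆ ℝ^ι` — a located flat `{x | ∀ t, cv t ⬝ᵥ x = δ t}` (faces and
faces of faces are of this form) and a linear map `L` (block projection, re-signing, quotient) under which that section of `Z` lands between
the rooted rank-one points `(1,𝟙_b)(1,𝟙_b)ᵀ` and the clique cone `cone{bbᵀ}` of `Sym_{n+1}` — prices every EF of `Z`: `3^n ≤ (r+1)·2^n`
(`HasEFOfSize.inter_eqs` for the flat, `HasEFOfSize.image_linearMap` for the map, then the sandwich).  Contrapositive reading (N13 of the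
enemy spec): a budgeted set is FAN-CHEAP — no such witness beats its budget at any located level. -/
theorem three_pow_le_of_witness {ι : Type} [Fintype ι] {Z : Set (ι → ℝ)} {n r k : ℕ}
    (cv : Fin k → ι → ℝ) (δ : Fin k → ℝ) (L : (ι → ℝ) →ₗ[ℝ] (Fin (n + 1) × Fin (n + 1) → ℝ))
    (hpts : ∀ b : Finset (Fin n), vPt b ∈ L '' (Z ∩ {x | ∀ t, cv t ⬝ᵥ x = δ t}))
    (hsub : L '' (Z ∩ {x | ∀ t, cv t ⬝ᵥ x = δ t}) ⊆ cliqueCone (n + 1))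
    (hZ : HasEFOfSize Z r) : 3 ^ n ≤ (r + 1) * 2 ^ n :=
  sandwich_three_pow_le hpts hsub ((hZ.inter_eqs cv δ).image_linearMap L)

/-- ★ THE SCHEMA (kernel sentence): a witness of dimension `n` with `(R+1)·2^n < 3^n` forbids an EF of size `R` — `CovZonoHard` holds for
every FAN-EXPENSIVE covering zonotope. -/
theorem not_hasEF_of_witness {ι : Type} [Fintype ι] {Z : Set (ι → ℝ)} {n R k : ℕ} (hlt : (R + 1) * 2 ^ n < 3 ^ n)
    (cv : Fin k → ι → ℝ) (δ : Fin k → ℝ) (L : (ι → ℝ) →ₗ[ℝ] (Fin (n + 1) × Fin (n + 1) → ℝ))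
    (hpts : ∀ b : Finset (Fin n), vPt b ∈ L '' (Z ∩ {x | ∀ t, cv t ⬝ᵥ x = δ t}))
    (hsub : L '' (Z ∩ {x | ∀ t, cv t ⬝ᵥ x = δ t}) ⊆ cliqueCone (n + 1)) : ¬ HasEFOfSize Z R :=
  fun hZ => absurd (three_pow_le_of_witness cv δ L hpts hsub hZ) (not_le.mpr hlt)

/-- sanity instance: `Z_full(n+1)` carries the trivial witness (no equations, identity map), so it has no EF of size `R` with
`(R+1)·2^n < 3^n`. -/
theorem zFull_not_hasEF {n R : ℕ} (h : (R + 1) * 2 ^ n < 3 ^ n) : ¬ HasEFOfSize (zFull (n + 1)) R := by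
  refine not_hasEF_of_witness h (Fin.elim0 : Fin 0 → _) Fin.elim0 LinearMap.id
    (fun b => ⟨vPt b, ⟨vPt_mem_zFull b, fun t => t.elim0⟩, rfl⟩) ?_
  rintro _ ⟨x, ⟨hx, -⟩, rfl⟩
  exact zFull_subset_cliqueCone (n + 1) hx

/-! ## 10. P-R2a — kernel: the antitone cone has an explicit slack-form EF of size `2h² + h`
(variables `u_xt ≥ 0`, slacks `s_xt = u_xt − W_xt ≥ 0`, row slacks `σ_x = −(W_xx + 2Σ_t u_xt) ≥ 0`; rows: symmetry, domination, row sums). -/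

section antitoneEF

/-- symmetry rows: `(Esym W)(p,q) = W(p,q) − W(q,p)`. -/
def Esym (h : ℕ) : Matrix (Fin h × Fin h) (Fin h × Fin h) ℝ :=
  Matrix.of fun r c => (if c = r then (1:ℝ) else 0) - (if c = (r.2, r.1) then 1 else 0)

/-- diagonal-extraction rows: `(Erow W) x = W(x,x)`. -/
def Erow (h : ℕ) : Matrix (Fin h) (Fin h × Fin h) ℝ := Matrix.of fun x c => if c = (x, x) then (1:ℝ) else 0

/-- row sums of the dominating variables: `(U2 u) x = 2·Σ_t u(x,t)`. -/
def U2 (h : ℕ) : Matrix (Fin h) (Fin h × Fin h) ℝ := Matrix.of fun x c => if c.1 = x then (2:ℝ) else 0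

/-- row `r` of `Esym h *ᵥ W` is the antisymmetric defect `W r − W (r.2, r.1)`. -/
theorem Esym_mulVec_apply (W : Fin h × Fin h → ℝ) (r : Fin h × Fin h) :
    (Esym h *ᵥ W) r = W r - W (r.2, r.1) := by
  classical
  simp [Esym, Matrix.mulVec, dotProduct, sub_mul, Finset.sum_sub_distrib, ite_mul, Finset.sum_ite_eq']

/-- row `x` of `Erow h *ᵥ W` reads the diagonal entry `W (x, x)`. -/
theorem Erow_mulVec_apply (W : Fin h × Fin h → ℝ) (x : Fin h) : (Erow h *ᵥ W) x = W (x, x) := by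
  classical
  simp [Erow, Matrix.mulVec, dotProduct, ite_mul, Finset.sum_ite_eq']

/-- row `x` of `U2 h *ᵥ u` is twice the row sum `∑_t u (x, t)`. -/
theorem U2_mulVec_apply (u : Fin h × Fin h → ℝ) (x : Fin h) : (U2 h *ᵥ u) x = 2 * ∑ t, u (x, t) := by
  classical
  simp only [U2, Matrix.mulVec, dotProduct, Matrix.of_apply, Fintype.sum_prod_type]
  rw [Finset.sum_eq_single x (fun a _ ha => by simp [ha]) (by simp)]
  simp [Finset.mul_sum]

/-- the natural-variable matrix of the system. -/
def antiE (h : ℕ) : Matrix ((Fin h × Fin h) ⊕ ((Fin h × Fin h) ⊕ Fin h)) (Fin h × Fin h) ℝ :=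
  Matrix.fromRows (Esym h) (Matrix.fromRows 1 (Erow h))

/-- the slack-variable matrix of the system (columns: `u`, `s`, `σ`). -/
def antiF (h : ℕ) :
    Matrix ((Fin h × Fin h) ⊕ ((Fin h × Fin h) ⊕ Fin h)) ((Fin h × Fin h) ⊕ ((Fin h × Fin h) ⊕ Fin h)) ℝ :=
  Matrix.fromRows 0 (Matrix.fromRows (Matrix.fromCols (-1) (Matrix.fromCols 1 0))
    (Matrix.fromCols (U2 h) (Matrix.fromCols 0 1)))

/-- first block row of the slack system `antiE h *ᵥ W + antiF h *ᵥ y`. -/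
theorem anti_row₁ (W : Fin h × Fin h → ℝ) (y : (Fin h × Fin h) ⊕ ((Fin h × Fin h) ⊕ Fin h) → ℝ) (r : Fin h × Fin h) :
    (antiE h *ᵥ W + antiF h *ᵥ y) (Sum.inl r) = W r - W (r.2, r.1) := by
  simp [antiE, antiF, Matrix.fromRows_mulVec, Esym_mulVec_apply]

/-- second block row of the slack system `antiE h *ᵥ W + antiF h *ᵥ y`. -/
theorem anti_row₂ (W : Fin h × Fin h → ℝ) (y : (Fin h × Fin h) ⊕ ((Fin h × Fin h) ⊕ Fin h) → ℝ) (c : Fin h × Fin h) :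
    (antiE h *ᵥ W + antiF h *ᵥ y) (Sum.inr (Sum.inl c)) = W c - y (Sum.inl c) + y (Sum.inr (Sum.inl c)) := by
  simp [antiE, antiF, Matrix.fromRows_mulVec, Matrix.fromBlocks_mulVec, Matrix.neg_mulVec]
  ring

/-- third block row of the slack system `antiE h *ᵥ W + antiF h *ᵥ y`. -/
theorem anti_row₃ (W : Fin h × Fin h → ℝ) (y : (Fin h × Fin h) ⊕ ((Fin h × Fin h) ⊕ Fin h) → ℝ) (x : Fin h) :
    (antiE h *ᵥ W + antiF h *ᵥ y) (Sum.inr (Sum.inr x))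
      = W (x, x) + 2 * ∑ t, y (Sum.inl (x, t)) + y (Sum.inr (Sum.inr x)) := by
  simp [antiE, antiF, Matrix.fromRows_mulVec, Matrix.fromBlocks_mulVec, Erow_mulVec_apply, U2_mulVec_apply]
  ring

/-- `max a 0` as an `if`. -/
theorem max_zero_eq_ite (a : ℝ) : max a 0 = if 0 < a then a else 0 := by
  split_ifs with ha
  · exact max_eq_left ha.le
  · exact max_eq_right (not_lt.mp ha)

/-- ★ the antitone cone IS the projection of the slack-form system. -/
theorem antitoneCone_eq_system (h : ℕ) :
    antitoneCone h = {W | ∃ y : (Fin h × Fin h) ⊕ ((Fin h × Fin h) ⊕ Fin h) → ℝ,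
      (∀ j, 0 ≤ y j) ∧ antiE h *ᵥ W + antiF h *ᵥ y = 0} := by
  classical
  ext W
  simp only [antitoneCone, Set.mem_setOf_eq]
  constructor
  · rintro ⟨hsym, hanti⟩
    have hdiag : ∀ x, W (x, x) ≤ 0 := fun x => by simpa using hanti x ∅ (by simp)
    refine ⟨Sum.elim (fun c => max (W c) 0) (Sum.elim (fun c => max (W c) 0 - W c)
      (fun x => -(W (x, x) + 2 * ∑ t, max (W (x, t)) 0))), ?_, ?_⟩
    · rintro (c | c | x)
      · simp
      · simp
      · simp only [Sum.elim_inr, neg_nonneg]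
        have hsum : ∑ t, max (W (x, t)) 0 = ∑ t ∈ Finset.univ.filter (fun t => 0 < W (x, t)), W (x, t) := by
          rw [Finset.sum_filter]
          exact Finset.sum_congr rfl fun t _ => max_zero_eq_ite _
        have hx : x ∉ Finset.univ.filter (fun t => 0 < W (x, t)) := by simp [not_lt.mpr (hdiag x)]
        have := hanti x _ hx
        linarith [hsum]
    · funext i
      rcases i with r | c | x
      · rw [anti_row₁]; simp [hsym r.1 r.2]
      · rw [anti_row₂]; simp
      · rw [anti_row₃]; simp
  · rintro ⟨y, hy, hsys⟩
    have e₁ : ∀ r : Fin h × Fin h, W r - W (r.2, r.1) = 0 := fun r => by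
      have := congrFun hsys (Sum.inl r); rwa [anti_row₁] at this
    have e₂ : ∀ c : Fin h × Fin h, W c - y (Sum.inl c) + y (Sum.inr (Sum.inl c)) = 0 := fun c => by
      have := congrFun hsys (Sum.inr (Sum.inl c)); rwa [anti_row₂] at this
    have e₃ : ∀ x : Fin h, W (x, x) + 2 * ∑ t, y (Sum.inl (x, t)) + y (Sum.inr (Sum.inr x)) = 0 := fun x => by
      have := congrFun hsys (Sum.inr (Sum.inr x)); rwa [anti_row₃] at this
    refine ⟨fun p q => by linarith [e₁ (p, q)], fun x T hxT => ?_⟩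
    have hdom : ∀ t, W (x, t) ≤ y (Sum.inl (x, t)) := fun t => by linarith [e₂ (x, t), hy (Sum.inr (Sum.inl (x, t)))]
    have h1 : ∑ t ∈ T, W (x, t) ≤ ∑ t ∈ T, y (Sum.inl (x, t)) := Finset.sum_le_sum fun t _ => hdom t
    have h2 : ∑ t ∈ T, y (Sum.inl (x, t)) ≤ ∑ t, y (Sum.inl (x, t)) :=
      Finset.sum_le_sum_of_subset_of_nonneg (Finset.subset_univ T) fun t _ _ => hy _
    linarith [e₃ x, hy (Sum.inr (Sum.inr x))]

/-- ★ PROVED (P-R2a): the antitone cone has a slack-form EF of size `h² + (h² + h) = 2h² + h`. -/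
theorem antitoneCone_hasEF (h : ℕ) : HasEFOfSize (antitoneCone h) (2 * h * h + h) := by
  classical
  have h0 := Literature.Barriers.PneNP.hasEFOfSize_of_system (ι := Fin h × Fin h) (antiE h) (antiF h) 0
  rw [← antitoneCone_eq_system] at h0
  simp only [Fintype.card_sum, Fintype.card_prod, Fintype.card_fin] at h0
  convert h0 using 1
  ring




/-- ★ PROVED (P-R2a, «polar = the pairing identity», generator level): a symmetric `W` is ANTITONE iff it prices every corona
generator `P_{A∪B} − P_B` (`A, B` disjoint) nonpositively — `⟸` by the singleton generators `A = {x}`, `⟹` by telescoping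
(`qf_union_le`).  Composed with the finite bipolar theorem for the finitely generated cone `coronaCone h` this is exactly
`CoronaConePolarAntitone`; that Farkas step is the only part of (C3) left typed. -/
theorem antitone_iff_generators_nonpos (W : Fin h × Fin h → ℝ) (hW : ∀ p q, W (p, q) = W (q, p)) :
    W ∈ antitoneCone h ↔ ∀ A B : Finset (Fin h), Disjoint A B → W ⬝ᵥ coronaKernel A B ≤ 0 := by
  classical
  constructor
  · intro hA A B hAB
    rw [dot_coronaKernel]
    linarith [qf_union_le W hA A B hAB]
  · intro hgen
    refine ⟨hW, fun x T hxT => ?_⟩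
    have h1 := hgen {x} T (Finset.disjoint_singleton_left.mpr hxT)
    rw [dot_coronaKernel, ← Finset.insert_eq, qf_insert W hW hxT] at h1
    linarith

end antitoneEF


/-! ## 11. (C3) closed in kernel — the corona cone is EXACTLY the polar of the antitone cone (Farkas half via the in-tree
conic Farkas lemma `Literature.Barriers.PneNP.farkas`) -/

section polar

/-- clique correlation vertices are symmetric. -/
theorem corVec_top_symm {m : ℕ} (b : Fin m → Bool) (p q : Fin m) :
    corVec (⊤ : SimpleGraph (Fin m)) b (p, q) = corVec (⊤ : SimpleGraph (Fin m)) b (q, p) := by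
  rw [corVec_top_apply, corVec_top_apply, mul_comm]

/-- corona kernels are symmetric. -/
theorem coronaKernel_symm (A B : Finset (Fin h)) (p q : Fin h) :
    coronaKernel A B (p, q) = coronaKernel A B (q, p) := by
  simp only [coronaKernel, Pi.sub_apply, corVec_top_symm]

/-- the corona kernel with empty top block vanishes. -/
theorem coronaKernel_empty (B : Finset (Fin h)) : coronaKernel (∅ : Finset (Fin h)) B = 0 := by
  simp [coronaKernel]

/-- symmetrisation `(y + yᵀ)/2`. -/
def symz (y : Fin h × Fin h → ℝ) : Fin h × Fin h → ℝ := fun pq => (y pq + y (pq.2, pq.1)) / 2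

/-- `symz y` is symmetric. -/
theorem symz_symm (y : Fin h × Fin h → ℝ) (p q : Fin h) : symz y (p, q) = symz y (q, p) := by
  simp only [symz]; ring

/-- symmetrising `y` does not change its pairing with a symmetric `v`. -/
theorem symz_dot_of_symm (y v : Fin h × Fin h → ℝ) (hv : ∀ p q, v (p, q) = v (q, p)) :
    symz y ⬝ᵥ v = y ⬝ᵥ v := by
  have hswap : ∑ pq : Fin h × Fin h, y (pq.2, pq.1) * v pq = ∑ pq : Fin h × Fin h, y pq * v pq := by
    calc ∑ pq : Fin h × Fin h, y (pq.2, pq.1) * v pq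
        = ∑ pq : Fin h × Fin h, (fun pq : Fin h × Fin h => y pq * v (pq.2, pq.1)) (Equiv.prodComm (Fin h) (Fin h) pq) := rfl
      _ = ∑ pq : Fin h × Fin h, y pq * v (pq.2, pq.1) :=
          Equiv.sum_comp (Equiv.prodComm (Fin h) (Fin h)) (fun pq : Fin h × Fin h => y pq * v (pq.2, pq.1))
      _ = ∑ pq : Fin h × Fin h, y pq * v pq := Fintype.sum_congr _ _ fun pq => by rw [← hv pq.1 pq.2]
  have hsplit : ∑ pq : Fin h × Fin h, (y pq + y (pq.2, pq.1)) / 2 * v pq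
      = (∑ pq : Fin h × Fin h, y pq * v pq) / 2 + (∑ pq : Fin h × Fin h, y (pq.2, pq.1) * v pq) / 2 := by
    rw [Finset.sum_div, Finset.sum_div, ← Finset.sum_add_distrib]
    exact Finset.sum_congr rfl fun pq _ => by ring
  simp only [dotProduct, symz]
  rw [hsplit, hswap]
  ring

/-- ★ PROVED (the Farkas half of (C3)): a symmetric `x` that every antitone `W` prices nonpositively lies in the corona cone. -/
theorem mem_coronaCone_of_polar {x : Fin h × Fin h → ℝ} (hx : ∀ p q, x (p, q) = x (q, p))
    (hpol : ∀ W ∈ antitoneCone h, ∑ p, W p * x p ≤ 0) : x ∈ coronaCone h := by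
  classical
  let a : Finset (Fin h) × Finset (Fin h) → (Fin h × Fin h → ℝ) := fun AB =>
    if AB.1 = ∅ ∨ ¬ Disjoint AB.1 AB.2 then 0 else coronaKernel AB.1 AB.2
  rcases Literature.Barriers.PneNP.farkas a x with ⟨lam, hlam, hxlam⟩ | ⟨y, hy, hxy⟩
  · refine ⟨fun AB => if AB.1 = ∅ ∨ ¬ Disjoint AB.1 AB.2 then 0 else lam AB, fun AB => ?_, fun AB hAB => ?_, ?_⟩
    · dsimp only
      split_ifs
      · exact le_rfl
      · exact hlam AB
    · dsimp only
      rw [if_pos hAB]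
    · funext v
      rw [hxlam v, Finset.sum_apply]
      refine Finset.sum_congr rfl fun AB _ => ?_
      simp only [Pi.smul_apply, smul_eq_mul, a]
      split_ifs <;> simp
  · exfalso
    have hWsym : ∀ p q, (-symz y) (p, q) = (-symz y) (q, p) := fun p q => by
      simp only [Pi.neg_apply, symz_symm y p q]
    have hW : -symz y ∈ antitoneCone h := by
      rw [antitone_iff_generators_nonpos _ hWsym]
      intro A B hAB
      rw [neg_dotProduct, symz_dot_of_symm _ _ (coronaKernel_symm A B), neg_nonpos]
      by_cases hA : A = ∅
      · subst hA; simp [coronaKernel_empty]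
      · have := hy (A, B)
        simp [a, hA, hAB] at this
        rwa [dotProduct_comm] at this
    have h1 := hpol _ hW
    have h2 : ∑ p, (-symz y) p * x p = -(x ⬝ᵥ y) := by
      rw [show (∑ p, (-symz y) p * x p) = (-symz y) ⬝ᵥ x from rfl, neg_dotProduct,
        symz_dot_of_symm _ _ hx, dotProduct_comm]
    linarith

/-- ★ POLARITY — (C3) is a kernel theorem: the apex normal chamber of the unrestricted corona zonotope `Z'_cor` is EXACTLY the antitone
cone (containment half `antitone_dot_corona_nonpos`; Farkas half `mem_coronaCone_of_polar`). -/
theorem coronaCone_polar_antitone (h : ℕ) (x : Fin h × Fin h → ℝ) (hx : ∀ p q, x (p, q) = x (q, p)) :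
    x ∈ coronaCone h ↔ ∀ W ∈ antitoneCone h, ∑ p, W p * x p ≤ 0 :=
  ⟨fun hxC _ hW => antitone_dot_corona_nonpos hW hxC, mem_coronaCone_of_polar hx⟩

end polar



/-! ## 13. Loose end: the UNROOTED clique cone is hard too (2-line corollary of the sandwich — the BFPS functionals are nonpositive on
the whole unrooted cone, so no face argument is needed). -/

/-- ★ the UNROOTED clique cone `cone{bbᵀ}` is hard too. -/
theorem cliqueCone_three_pow_le (n r : ℕ) (hEF : HasEFOfSize (cliqueCone (n + 1)) r) : 3 ^ n ≤ (r + 1) * 2 ^ n :=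
  sandwich_three_pow_le (fun b => zFull_subset_cliqueCone (n + 1) (vPt_mem_zFull b)) subset_rfl hEF

end ConePricing

end Summit.ValiantsHypothesis.ValiantsHypothesis.Theorems.FifoMatching

end
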